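import Literature.NumberTheory.LFunctions.WeilFiniteCodimension
import Literature.NumberTheory.LFunctions.WeilSemilocalNegative
import HarnessLib

/-!
# Finite-codimension coercivity of the SEMI-LOCAL Weil forms on every window

The soft half of the Connes–Consani programme at a finite set of places: for every finite set of
primes `S`, every window `[-a, a]` and every level `μ`, the semi-local Weil quadratic form
`Q_S(g) = W_{S ∪ {∞}}(g ⋆ g̃)` (`weilSemilocalQuadratic S`, primes restricted to `S`) satisfies
`Re Q_S(g) ≥ μ ‖g‖₂²` for every Weil test function `g` on `[-a, a]` whose Mellin–Laplace transform
vanishes at the `N + 1` points of a fine grid of the critical segment `1/2 + i[-T, T]`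
(`weilSemilocalQuadratic_re_ge_of_grid_zero`).  In particular (`μ = 0`) the semi-local form is
positive modulo finitely many linear conditions on EVERY window
(`weilSemilocalQuadratic_re_nonneg_of_grid_zero`) — to be contrasted with
`exists_not_weilSemilocalPositivityOn_two` / `eventually_not_weilSemilocalPositivityOn_two`:
WITHOUT conditions the semi-local form at `S = {2}` is NOT positive on large windows.

This is the semi-local analogue of [Yoshida 1992, §3 Lemma 3 (p. 290)] and of the finite-codimension
half of [Connes–Consani 2021 (arXiv:2006.13771), Thm. 17 (arXiv numbering) and the preceding paragraph: "finitely many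
linear conditions"] at the places `S ∪ {∞}`; it follows from the archimedean-full statement
`weilQuadratic_re_ge_of_grid_zero` (file `WeilFiniteCodimension`) and the elementary comparison
`Re Q(g) ≤ Re Q_S(g) + 4 (Σ_{n ≤ e^{2a}} Λ(n)/√n) ‖g‖₂²` on the window `[-a, a]`
(both prime terms are finite sums bounded termwise, [Bombieri 2000, Lemmas 2–3 shape]).

All statements are PROVED here (no named facts); hypotheses are explicit.
-/

open Complex Filter Set MeasureTheory
open scoped Real Topology ComplexConjugate ArithmeticFunction.vonMangoldt

namespace Literature.NumberTheory.LFunctions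

open Literature.Analysis.SpecialFunctions

variable {g : ℝ → ℂ}

/-- The `S`-smooth coefficient is dominated by the full one: `Λ_S(n)/√n ≤ Λ(n)/√n`. [folklore] -/
theorem weilSemilocalCoeff_le (S : Finset ℕ) (n : ℕ) :
    weilSemilocalCoeff S n ≤ (Λ n : ℝ) / Real.sqrt n := by
  unfold weilSemilocalCoeff
  split_ifs with h
  · exact le_rfl
  · exact div_nonneg ArithmeticFunction.vonMangoldt_nonneg (Real.sqrt_nonneg _)

/-- **Bound for the semi-local prime term on a window**: for a continuous `k` with
`tsupport k ⊆ [-b, b]` and `‖k‖ ≤ M₀`,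
`‖Σ_{n S-smooth} Λ(n) n^{-1/2} (k(log n) + k(-log n))‖ ≤ 2 M₀ Σ_{n ≤ e^b} Λ(n)/√n`.
[cite: Bombieri2000, Lemmas 2–3 shape (finite prime sum on a window), primes restricted to S] -/
theorem norm_weilSemilocalPrimeTerm_le_of_tsupport_subset (S : Finset ℕ) {k : ℝ → ℂ}
    (hk : Continuous k) {b M₀ : ℝ} (hsupp : tsupport k ⊆ Icc (-b) b) (hM : ∀ t, ‖k t‖ ≤ M₀) :
    ‖weilSemilocalPrimeTerm S k‖ ≤
      2 * M₀ * ∑ n ∈ Finset.range (⌊Real.exp b⌋₊ + 1), (Λ n : ℝ) / Real.sqrt n := by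
  set N : ℕ := ⌊Real.exp b⌋₊ with hN
  have hM0 : 0 ≤ M₀ := (norm_nonneg _).trans (hM 0)
  have hb : b ≤ Real.log ((N : ℝ) + 1) := by
    have h1 : Real.exp b < (N : ℝ) + 1 := by rw [hN]; exact Nat.lt_floor_add_one _
    have := Real.log_le_log (Real.exp_pos b) h1.le
    rwa [Real.log_exp] at this
  have hsupp' : tsupport k ⊆ Icc (-Real.log ((N : ℝ) + 1)) (Real.log ((N : ℝ) + 1)) :=
    hsupp.trans (Icc_subset_Icc (neg_le_neg hb) hb)
  rw [weilSemilocalPrimeTerm_eq_sum_of_tsupport_subset S hk N hsupp', Finset.mul_sum]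
  refine (norm_sum_le _ _).trans (Finset.sum_le_sum fun n _ ↦ ?_)
  rw [norm_mul, Complex.norm_real, Real.norm_of_nonneg (weilSemilocalCoeff_nonneg _ _)]
  have hkk : ‖k (Real.log n) + k (-Real.log n)‖ ≤ 2 * M₀ :=
    (norm_add_le _ _).trans (by linarith [hM (Real.log n), hM (-Real.log n)])
  calc weilSemilocalCoeff S n * ‖k (Real.log n) + k (-Real.log n)‖
      ≤ ((Λ n : ℝ) / Real.sqrt n) * (2 * M₀) :=
        mul_le_mul (weilSemilocalCoeff_le S n) hkk (norm_nonneg _)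
          (div_nonneg ArithmeticFunction.vonMangoldt_nonneg (Real.sqrt_nonneg _))
    _ = 2 * M₀ * ((Λ n : ℝ) / Real.sqrt n) := by ring

/-- **The semi-local and the full Weil form differ by a bounded form on each window**:
for `tsupport g ⊆ [-a, a]`,
`Re Q(g) ≤ Re Q_S(g) + 4 (Σ_{n ≤ e^{2a}} Λ(n)/√n) ‖g‖₂²`. [folklore] -/
theorem weilQuadratic_re_le_weilSemilocalQuadratic_re_add (S : Finset ℕ) (hg : IsWeilTest g) {a : ℝ}
    (hsupp : tsupport g ⊆ Icc (-a) a) :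
    (weilQuadratic g).re ≤ (weilSemilocalQuadratic S g).re +
      4 * (∑ n ∈ Finset.range (⌊Real.exp (2 * a)⌋₊ + 1), (Λ n : ℝ) / Real.sqrt n) *
        ∫ t : ℝ, ‖g t‖ ^ 2 := by
  set k : ℝ → ℂ := weilConv g (weilReflect g) with hk
  have hkt : IsWeilTest k := hg.weilConv hg.weilReflect
  have hks : tsupport k ⊆ Icc (-(2 * a)) (2 * a) := tsupport_weilConv_weilReflect_subset hg.2 hsupp
  set Sg : ℝ := ∑ n ∈ Finset.range (⌊Real.exp (2 * a)⌋₊ + 1), (Λ n : ℝ) / Real.sqrt n with hSg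
  set N2 : ℝ := ∫ t : ℝ, ‖g t‖ ^ 2 with hN2
  have hfull : ‖weilPrimeTerm k‖ ≤ 2 * N2 * Sg :=
    norm_weilPrimeTerm_le_of_tsupport_subset hkt.1.continuous hks
      (fun t ↦ norm_weilConv_weilReflect_le hg t)
  have hsemi : ‖weilSemilocalPrimeTerm S k‖ ≤ 2 * N2 * Sg :=
    norm_weilSemilocalPrimeTerm_le_of_tsupport_subset S hkt.1.continuous hks
      (fun t ↦ norm_weilConv_weilReflect_le hg t)
  have hdiff : (weilQuadratic g).re - (weilSemilocalQuadratic S g).re =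
      (weilSemilocalPrimeTerm S k).re - (weilPrimeTerm k).re := by
    simp only [weilQuadratic, weilFunctional, weilSemilocalQuadratic, weilSemilocalFunctional, ← hk,
      Complex.add_re, Complex.sub_re]
    ring
  have h1 : (weilSemilocalPrimeTerm S k).re ≤ 2 * N2 * Sg := (Complex.re_le_norm _).trans hsemi
  have h2 : -(2 * N2 * Sg) ≤ (weilPrimeTerm k).re := by
    have := (Complex.abs_re_le_norm (weilPrimeTerm k)).trans hfull
    exact (abs_le.1 this).1
  linarith

/-- **Finite-codimension coercivity of the semi-local Weil form on every window** (semi-local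
analogue of Yoshida's Lemma 3, fine-grid variant): for every finite set of primes `S`, every `a > 0`
and every level `μ : ℝ` there are `T > 0` and `N ≥ 1` such that every Weil test function `g` with
`tsupport g ⊆ [-a, a]` whose Mellin–Laplace transform vanishes at the `N + 1` grid points
`1/2 + i(-T + 2Tj/N)`, `j = 0, …, N`, satisfies `μ ‖g‖₂² ≤ Re Q_S(g)`.
[cite: Yoshida1992HermitianForms, §3 Lemma 3 (p. 290), at the places S ∪ {∞}; ConnesConsani2021, Thm. 17 and the preceding paragraph (arXiv:2006.13771 numbering, p. 13) ("positive modulo finitely many linear conditions" / finitely many negative eigenvalues), semi-local analogue] -/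
theorem weilSemilocalQuadratic_re_ge_of_grid_zero (S : Finset ℕ) {a : ℝ} (ha : 0 < a) (μ : ℝ) :
    ∃ T : ℝ, 0 < T ∧ ∃ N : ℕ, 1 ≤ N ∧ ∀ g : ℝ → ℂ, IsWeilTest g → tsupport g ⊆ Icc (-a) a →
      (∀ j : ℕ, j ≤ N → weilMellin g (1 / 2 + ((-T + j * (2 * T / N) : ℝ) : ℂ) * I) = 0) →
      μ * ∫ t : ℝ, ‖g t‖ ^ 2 ≤ (weilSemilocalQuadratic S g).re := by
  set C : ℝ := 4 * ∑ n ∈ Finset.range (⌊Real.exp (2 * a)⌋₊ + 1), (Λ n : ℝ) / Real.sqrt n with hC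
  obtain ⟨T, hT, N, hN, h⟩ := weilQuadratic_re_ge_of_grid_zero ha (μ + C)
  refine ⟨T, hT, N, hN, fun g hg hsupp hzero ↦ ?_⟩
  have hfull := h g hg hsupp hzero
  have hcmp := weilQuadratic_re_le_weilSemilocalQuadratic_re_add S hg hsupp
  rw [← hC] at hcmp
  have : (μ + C) * ∫ t : ℝ, ‖g t‖ ^ 2 = μ * (∫ t : ℝ, ‖g t‖ ^ 2) + C * ∫ t : ℝ, ‖g t‖ ^ 2 := by ring
  linarith

/-- Uniform-in-the-window version: one grid serves all windows `a ≤ a₀`. [cite: Yoshida1992HermitianForms, §3 Lemma 3 (p. 290), at the places S ∪ {∞}] -/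
theorem weilSemilocalQuadratic_re_ge_of_grid_zero_uniform (S : Finset ℕ) {a₀ : ℝ} (ha₀ : 0 < a₀)
    (μ : ℝ) :
    ∃ T : ℝ, 0 < T ∧ ∃ N : ℕ, 1 ≤ N ∧ ∀ a : ℝ, a ≤ a₀ → ∀ g : ℝ → ℂ, IsWeilTest g →
      tsupport g ⊆ Icc (-a) a →
      (∀ j : ℕ, j ≤ N → weilMellin g (1 / 2 + ((-T + j * (2 * T / N) : ℝ) : ℂ) * I) = 0) →
      μ * ∫ t : ℝ, ‖g t‖ ^ 2 ≤ (weilSemilocalQuadratic S g).re := by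
  obtain ⟨T, hT, N, hN, h⟩ := weilSemilocalQuadratic_re_ge_of_grid_zero S ha₀ μ
  exact ⟨T, hT, N, hN, fun a ha g hg hsupp hzero ↦
    h g hg (hsupp.trans (Icc_subset_Icc (neg_le_neg ha) ha)) hzero⟩

/-- **Semi-local positivity modulo finitely many linear conditions on every window** (`μ = 0`):
unconditionally, for every finite `S` and every `a > 0`; contrast
`eventually_not_weilSemilocalPositivityOn_two` (no conditions ⇒ positivity FAILS at `S = {2}` on all
large windows) and Weil's criterion `riemannHypothesis_iff_forall_weilPositivityOn` (no conditions, all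
primes, all windows ⇔ RH). [cite: ConnesConsani2021, Thm. 17 and the preceding paragraph (arXiv:2006.13771 numbering, p. 13), semi-local analogue; Yoshida1992HermitianForms §3 Lemma 3] -/
theorem weilSemilocalQuadratic_re_nonneg_of_grid_zero (S : Finset ℕ) {a : ℝ} (ha : 0 < a) :
    ∃ T : ℝ, 0 < T ∧ ∃ N : ℕ, 1 ≤ N ∧ ∀ g : ℝ → ℂ, IsWeilTest g → tsupport g ⊆ Icc (-a) a →
      (∀ j : ℕ, j ≤ N → weilMellin g (1 / 2 + ((-T + j * (2 * T / N) : ℝ) : ℂ) * I) = 0) →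
      0 ≤ (weilSemilocalQuadratic S g).re := by
  obtain ⟨T, hT, N, hN, h⟩ := weilSemilocalQuadratic_re_ge_of_grid_zero S ha 0
  exact ⟨T, hT, N, hN, fun g hg hsupp hzero ↦ by simpa using h g hg hsupp hzero⟩

end Literature.NumberTheory.LFunctions
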